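import Summits.BirchSwinnertonDyer.BirchSwinnertonDyer.Theses.ResidualThetaTransportAtTwo
import Summits.BirchSwinnertonDyer.BirchSwinnertonDyer.Theorems.ResidualThetaTransportAtTwoResidualSignedLambdaLowerCMAtTwoOfParts2
import Summits.BirchSwinnertonDyer.BirchSwinnertonDyer.Theorems.ResidualThetaTransportAtTwoResidualSignedLambdaLowerCMAtTwoStubPlusColemanO
import Summits.BirchSwinnertonDyer.BirchSwinnertonDyer.Theorems.ResidualThetaTransportAtTwoResidualSignedLambdaLowerCMAtTwoStubLocalDualAwayTwo
import Summits.BirchSwinnertonDyer.BirchSwinnertonDyer.Theorems.ResidualThetaTransportAtTwoResidualSignedLambdaLowerCMAtTwoStubDeepHalfAtTwoStrict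
import Summits.BirchSwinnertonDyer.BirchSwinnertonDyer.Theorems.ResidualThetaTransportAtTwoResidualSignedLambdaLowerCMAtTwoStubDeepHalfAwayTwo
import Summits.BirchSwinnertonDyer.BirchSwinnertonDyer.Theorems.ResidualThetaTransportAtTwoResidualSignedLambdaLowerCMAtTwoStubReciprocity
import Summits.BirchSwinnertonDyer.BirchSwinnertonDyer.Theorems.ResidualThetaTransportAtTwoResidualSignedLambdaLowerCMAtTwoStubOnePairSupply
import Literature.NumberTheory.EllipticCurves.CMNewformGamma0LevelSquarefull
import HarnessLib

/-!
# RSL_g from its two PRINTS: `KatoZetaCMFormAtTwoSupply → cmNewform_gamma0_sq_dvd_level → ResidualSignedLambdaLowerCMAtTwo`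

Route `ResidualThetaTransportAtTwo` (RTT), crux RSL_g `ResidualSignedLambdaLowerCMAtTwo` (stmt-BirchSwinnertonDyer-22608), line «onepair»
(skeleton `Cruxes/ResidualSignedLambdaLowerCMAtTwo/Lines/onepair.lean`, v3e). LEAD `prover-bsd-wall-rtt-p2` g20; `--supports 22608 --as helper`.
THEOREM ONLY. This file is the line's COMPOSITION `ResidualSignedLambdaLowerCMAtTwo_of` with every KERNEL stub discharged BY NAME by its landed
Theorems file and the two PRINT stubs taken as NAMED-FACT hypotheses:

* `hKZ : Theses.ResidualThetaTransportAtTwo.KatoZetaCMFormAtTwoSupply` — KZ_g, the route's HOLD support item stmt-BirchSwinnertonDyer-24105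
  (text = the registered stub `stub_katoZetaCMAtTwo`, S3″, verbatim): Kato 2004 for the CM newform `g` at `p = 2` — Iwasawa cohomology data
  (Thm. 12.4) BY NAME, a zeta element with the explicit-reciprocity image in rank form (Thm. 12.5 (1)) and the Euler-system divisibility in
  fine-Selmer currency (Thm. 12.5 (2) / 13.4, Burungale–Tian 2026 Thm. 2.6);
* `hLV : ModularForms.cmNewform_gamma0_sq_dvd_level` — LVsq, the Literature named fact (Ribet 1977 Thm. (4.5) with Cor. (3.5)): a CM newform on
  `Γ₀(M)` has squarefull level.

Everything else is kernel: S2 `OnePair.stub_plusColemanO` (p690960), S1⊕ `OnePair.stub_localDualAwayTwo` (p702453), S4₂ `OnePair.stub_deepHalfAtTwoStrict`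
(p702488), S4₀ `OnePair.stub_deepHalfAwayTwo` (tp2-p2x), EH `OnePair.stub_reciprocity` (tp2-p2x-w3), the GLUE `OnePair.stub_onePairSupply` (LEAD g19,
ASSEMBLY-SPEC-g19 clause files), composed by `LambdaLowerBoundO.residualSignedLambdaLowerCMAtTwo_of_parts₂` (p682462 lineage). So RSL_g is a
CONDITIONAL RESULT on exactly {24105, LVsq}; the item stays OPEN. BSD is not proved by any of this.

References: [Kato2004Asterisque] Thm. 12.4, 12.5 (1)(2), §13; [BurungaleTian2026] Thm. 2.6; [Ribet1977Nebentypus] §3 Cor. (3.5), §4 Thm. (4.5);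
[Kobayashi2003] Thm. 7.3; [MilneADT2006] Ch. I Thm. 4.10; [GreenbergVatsal2000] §2 Prop. 2.4.
-/

set_option autoImplicit false
-- the Theorems namespace of this sub repeats the summit name by design (D-0017 nested layout)
set_option linter.dupNamespace false

noncomputable section

namespace Summit.BirchSwinnertonDyer.BirchSwinnertonDyer.Theorems.OnePair

/-- **RSL_g from its two prints.** The residual signed λ-lower bound for the CM θ-partner at `p = 2` (`ResidualSignedLambdaLowerCMAtTwo`, crux
stmt-BirchSwinnertonDyer-22608) follows from the Kato-side print bundle KZ_g (`KatoZetaCMFormAtTwoSupply`, item stmt-BirchSwinnertonDyer-24105) and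
Ribet's squarefull-level fact LVsq (`cmNewform_gamma0_sq_dvd_level`); all other inputs of line «onepair» are landed kernel theorems, composed by
`LambdaLowerBoundO.residualSignedLambdaLowerCMAtTwo_of_parts₂`. Conditional result; BSD is not proved by this.
[cite: Kato2004Asterisque, Thm. 12.4 (p. 221), Thm. 12.5 (1)(2) (p. 222)] [cite: Ribet1977Nebentypus, §4 Thm. (4.5) with §3 Cor. (3.5)]
[cite: Kobayashi2003, Thm. 7.3 ((7.21), p. 13)] -/
theorem residualSignedLambdaLowerCMAtTwo_of_prints
    (hKZ : Summit.BirchSwinnertonDyer.BirchSwinnertonDyer.Theses.ResidualThetaTransportAtTwo.KatoZetaCMFormAtTwoSupply)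
    (hLV : Literature.NumberTheory.EllipticCurves.ModularForms.cmNewform_gamma0_sq_dvd_level) :
    Summit.BirchSwinnertonDyer.BirchSwinnertonDyer.Theses.ResidualThetaTransportAtTwo.ResidualSignedLambdaLowerCMAtTwo :=
  LambdaLowerBoundO.residualSignedLambdaLowerCMAtTwo_of_parts₂ hKZ.1 hKZ.2.2
    (stub_onePairSupply hLV stub_localDualAwayTwo stub_reciprocity stub_deepHalfAtTwoStrict stub_deepHalfAwayTwo stub_plusColemanO)

end Summit.BirchSwinnertonDyer.BirchSwinnertonDyer.Theorems.OnePair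

end
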